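import Literature.Topology.FourManifolds.HandleAttachingMapsAssoc
import HarnessLib

/-!
# N3 (`stub_STgeo`) ▸ N3-nat ▸ N3d-3: LIFTING AN ATTACHING MAP OF ANOTHER INDEX THROUGH A MULTI-ATTACHMENT
# (the old 2-handle maps `h k : T² → Base g` as 2-handle maps `E.jA ∘ h k` of `Base (g+1) = Base g ∪_{q1} 2 h¹`)
(wave 7, brick H6-9 of stub `stub_STgeo` = node N3 of NF4, line `modp-braid-orbits`, crux
`ConvexBisection.AcyclicBisectionExists`, item stmt-SmoothPoincare4-10508; registered sub-goal
`helper_liftIdx_apply`; design file `work/design/N3_Stabilisation_Design.lean` (G5, wave 6), piece N3d-3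
`node_rebase`: "`hold k := S.E.jA ∘ h k` (lifts: old ranges miss the model region)".)

The tree's `MultiAttachmentData.lift D ḡ hḡ` (`HandleAttachingMapsAssoc.lean`: an attaching map `ḡ` of
`M` whose range misses the ranges of the family `h̄ᵢ` is an attaching map `jA ∘ ḡ` of
`P = M ∪_{h̄} (handles)`) is stated for `ḡ` of THE SAME INDEX as the family.  Piece N3d-3 of the N3
design needs it ACROSS INDICES: the stabilised base data present `Base (g+1)` as `Base g` with two
INDEX-1 handles (`S.E : MultiAttachmentData S.q1 (𝓡∂ 4) (Base (g+1))`), and the old INDEX-2 Lefschetz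
maps `h k : T → Base g` (ranges off the model region, hence off the 1-handle ranges) must become 2-handle
attaching maps `hold k := S.E.jA ∘ h k` of `Base (g+1)`.  This file repeats Kosinski's lift verbatim with
an independent index `k'` for the lifted map (`liftPtIdx`, `MultiAttachmentData.liftIdx`; same proofs:
codomain restriction of an immersion to the open `M ∖ ⋃ h̄ᵢ(S)`, composite of embeddings, open range,
boundary to boundary), with its point formula (`liftIdx_apply`, registered `helper_liftIdx_apply`), its
attaching circle for `m = 4`, `k' = 2` (`attachingCircle_liftIdx`), the disjointness of lifted ranges
(`disjoint_range_liftIdx`) and "handles miss the lifted range" (`jA_liftPtIdx_ne_jB`).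
References: A. A. Kosinski, *Differential Manifolds* (1993), VI §6–7 ("the next handle is attached to
`M₁ = M ∪ H^λ`"; VII proof of (1.2)) [Kosinski1993].
-/

noncomputable section

-- the prescribed namespace `Summit.<P>.<Sub>.…` duplicates `SmoothPoincare4` (P = Sub)
set_option linter.dupNamespace false

open scoped Manifold ContDiff Topology
open Set Function Metric

namespace Summit.SmoothPoincare4.SmoothPoincare4.Theorems.AcyclicBisectionExists.ModpBraidOrbits

open Literature.Topology.FourManifolds Literature.Topology.FourManifolds.HandleAttachingMap

universe u

namespace MixedIndexLift

variable {n k k' : ℕ} {M : Type u} [TopologicalSpace M] [T2Space M]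
  [ChartedSpace (EuclideanHalfSpace (n + 1)) M]
  {ι : Type*} [Finite ι] {h : ι → HandleAttachingMap n k M}

/-! ## §1 The lifted point -/

/-- A point in the range of an attaching map `ḡ` (ANY index `k'`) whose range misses the ranges of the
`h̄ᵢ` (index `k`) lies off all the attaching spheres `h̄ᵢ(S)`. [folklore] -/
theorem apply_mem_coresComplement_of_disjoint {g : HandleAttachingMap n k' M}
    (hg : ∀ i, Disjoint (range g.toFun) (range (h i).toFun)) (y : ↥(handleTube n k')) :
    g.toFun y ∈ coresComplement h := by
  rw [mem_coresComplement]
  rintro i ⟨y', -, he⟩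
  exact Set.disjoint_left.1 (hg i) (mem_range_self y) (by rw [← he]; exact mem_range_self y')

section LiftPt

variable (g : HandleAttachingMap n k' M) (hg : ∀ i, Disjoint (range g.toFun) (range (h i).toFun))

/-- The point `ḡ(y)` as a point of `M ∖ ⋃ h̄ᵢ(S)`. [folklore] -/
def liftPtIdx (y : ↥(handleTube n k')) : ↥(coresComplement h) :=
  ⟨g.toFun y, apply_mem_coresComplement_of_disjoint hg y⟩

/-- The underlying point of `liftPtIdx`. [folklore] -/
@[simp] theorem coe_liftPtIdx (y : ↥(handleTube n k')) : (liftPtIdx g hg y : M) = g.toFun y := rfl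

/-- `liftPtIdx` is injective. [folklore] -/
theorem injective_liftPtIdx : Injective (liftPtIdx g hg) := fun _ _ e =>
  g.injective (congrArg Subtype.val e)

/-- `liftPtIdx` is a topological embedding. [folklore] -/
theorem isEmbedding_liftPtIdx : Topology.IsEmbedding (liftPtIdx g hg) :=
  Topology.IsEmbedding.of_comp (g.continuous.subtype_mk _) continuous_subtype_val
    g.isSmoothEmbedding.isEmbedding

/-- The range of `liftPtIdx` is open. [folklore] -/
theorem isOpen_range_liftPtIdx : IsOpen (range (liftPtIdx g hg)) := by
  have : range (liftPtIdx g hg) = Subtype.val ⁻¹' range g.toFun := by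
    ext a
    constructor
    · rintro ⟨y, rfl⟩; exact ⟨y, rfl⟩
    · rintro ⟨y, hy⟩; exact ⟨y, Subtype.ext hy⟩
  rw [this]
  exact g.isOpen_range.preimage continuous_subtype_val

end LiftPt

/-! ## §2 The lifted attaching map -/

variable [IsManifold (𝓡∂ (n + 1)) ∞ M]
  {P₁ : Type*} [TopologicalSpace P₁] [ChartedSpace (EuclideanHalfSpace (n + 1)) P₁]
  [IsManifold (𝓡∂ (n + 1)) ∞ P₁]
  (D : MultiAttachmentData h (𝓡∂ (n + 1)) P₁) (g : HandleAttachingMap n k' M)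
  (hg : ∀ i, Disjoint (range g.toFun) (range (h i).toFun))

/-- `jA ∘ liftPtIdx` is an immersion at every point. [folklore] -/
theorem isImmersionAt_jA_comp_liftPtIdx (y : ↥(handleTube n k')) :
    Manifold.IsImmersionAt (𝓡∂ (n + 1)) (𝓡∂ (n + 1)) ∞ (D.jA ∘ liftPtIdx g hg) y := by
  obtain ⟨F, _, _, hF⟩ := g.isSmoothEmbedding.isImmersion
  have h1 : Manifold.IsImmersionAtOfComplement F (𝓡∂ (n + 1)) (𝓡∂ (n + 1)) ∞
      (liftPtIdx g hg) y :=
    (hF y).codRestrict_opens (coresComplement h) (apply_mem_coresComplement_of_disjoint hg)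
  exact (h1.openEmbedding_comp D.hjA D.hjAo).isImmersionAt

/-- **The lifted attaching map `jA ∘ ḡ : T^{k'} → P₁` of an attaching map of index `k'` through a
multi-attachment of handles of index `k`** (Kosinski VI §7: the next handle, of any index, is attached to
`M₁ = M ∪ H^λ` along a map into `∂M₁` off the first handles). [cite: Kosinski1993, VI §6–7] -/
def _root_.Literature.Topology.FourManifolds.HandleAttachingMap.MultiAttachmentData.liftIdx :
    HandleAttachingMap n k' P₁ where
  toFun := D.jA ∘ liftPtIdx g hg
  isSmoothEmbedding :=
    ⟨Manifold.isImmersion_of_isImmersionAt_of_finrank_eq rfl (isImmersionAt_jA_comp_liftPtIdx D g hg),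
      D.hjA.isEmbedding.comp (isEmbedding_liftPtIdx g hg)⟩
  isOpen_range := by
    rw [range_comp]
    exact D.isOpenMap_jA _ (isOpen_range_liftPtIdx g hg)
  isBoundaryPoint y hy := by
    have h1 : g.toFun y ∈ (𝓡∂ (n + 1)).boundary M := g.isBoundaryPoint y hy
    have h2 : liftPtIdx g hg y ∈ (𝓡∂ (n + 1)).boundary ↥(coresComplement h) :=
      (mem_boundary_opens_iff (coresComplement h) _).2 h1
    exact (mem_boundary_iff_of_isSmoothEmbedding D.hjA D.hjAo _).2 h2

/-- The lifted attaching map on points. [folklore] -/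
@[simp] theorem liftIdx_apply (y : ↥(handleTube n k')) :
    (D.liftIdx g hg).toFun y = D.jA (liftPtIdx g hg y) := rfl

/-- The range of the lifted map is `jA` of the range of `ḡ`. [folklore] -/
theorem range_liftIdx : range (D.liftIdx g hg).toFun = D.jA '' (range (liftPtIdx g hg)) := by
  rw [← range_comp]; rfl

omit [IsManifold (𝓡∂ (n + 1)) ∞ M] [IsManifold (𝓡∂ (n + 1)) ∞ P₁] in
/-- **The handles of `P₁` miss the lifted range**: a common point `jA (ḡ y) = jBᵢ b` would be glued,
`ḡ y = h̄ᵢ y'`, contradicting the disjointness of the ranges. [folklore] -/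
theorem jA_liftPtIdx_ne_jB (y : ↥(handleTube n k')) (i : ι) (b : ↥(beltPiece n k)) :
    D.jA (liftPtIdx g hg y) ≠ D.jB i b := by
  intro he
  obtain ⟨y', -, -, hy'⟩ := (D.glue i _ _).1 he
  exact Set.disjoint_left.1 (hg i) (mem_range_self y)
    (by rw [coe_liftPtIdx] at hy'; rw [hy']; exact mem_range_self y')

/-- **Disjoint attaching maps lift to disjoint attaching maps** (`jA` is injective). [folklore] -/
theorem disjoint_range_liftIdx (g₁ g₂ : HandleAttachingMap n k' M)
    (hg₁ : ∀ i, Disjoint (range g₁.toFun) (range (h i).toFun))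
    (hg₂ : ∀ i, Disjoint (range g₂.toFun) (range (h i).toFun))
    (h12 : Disjoint (range g₁.toFun) (range g₂.toFun)) :
    Disjoint (range (D.liftIdx g₁ hg₁).toFun) (range (D.liftIdx g₂ hg₂).toFun) := by
  rw [Set.disjoint_left]
  rintro _ ⟨y₁, rfl⟩ ⟨y₂, he⟩
  have he' : liftPtIdx g₂ hg₂ y₂ = liftPtIdx g₁ hg₁ y₁ := D.injective_jA he
  have : g₂.toFun y₂ = g₁.toFun y₁ := congrArg Subtype.val he'
  exact Set.disjoint_left.1 h12 (mem_range_self y₁) (this ▸ mem_range_self y₂)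

end MixedIndexLift

/-! ## §3 The four-dimensional 2-handle case: the attaching circle of the lifted map -/

namespace MixedIndexLift

variable {k : ℕ} {M : Type u} [TopologicalSpace M] [T2Space M] [ChartedSpace (EuclideanHalfSpace 4) M]
  [IsManifold (𝓡∂ 4) ∞ M] {ι : Type*} [Finite ι] {h : ι → HandleAttachingMap 3 k M}
  {P₁ : Type*} [TopologicalSpace P₁] [ChartedSpace (EuclideanHalfSpace 4) P₁] [IsManifold (𝓡∂ 4) ∞ P₁]

/-- **The attaching circle of the lifted 2-handle map is `jA ∘` the attaching circle** (pointwise).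
[folklore] -/
theorem attachingCircle_liftIdx (D : MultiAttachmentData h (𝓡∂ 4) P₁) (g : HandleAttachingMap 3 2 M)
    (hg : ∀ i, Disjoint (range g.toFun) (range (h i).toFun))
    (θ : Metric.sphere (0 : EuclideanSpace ℝ (Fin 2)) 1) :
    (D.liftIdx g hg).attachingCircle θ =
      D.jA ⟨g.attachingCircle θ, apply_mem_coresComplement_of_disjoint hg (coreTubePt θ)⟩ := rfl

/-- The attaching circle of the lifted map, as a point of `M`, is the old attaching circle. [folklore] -/
theorem coe_attachingCircle_liftIdx (D : MultiAttachmentData h (𝓡∂ 4) P₁) (g : HandleAttachingMap 3 2 M)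
    (hg : ∀ i, Disjoint (range g.toFun) (range (h i).toFun)) :
    ∃ hmem : ∀ θ, g.attachingCircle θ ∈ coresComplement h,
      ∀ θ, (D.liftIdx g hg).attachingCircle θ = D.jA ⟨g.attachingCircle θ, hmem θ⟩ :=
  ⟨fun θ => apply_mem_coresComplement_of_disjoint hg (coreTubePt θ), fun _ => rfl⟩

end MixedIndexLift

/-! ## Registered helper -/

/-- **Registered helper `helper_liftIdx_apply` (sub-goal of `stub_STgeo` ▸ N3-nat ▸ N3d-3 `hold`, wave 7,
lead c5): the lifted attaching map of another index through a multi-attachment is `jA ∘ ḡ` on points.**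
[cite: Kosinski1993, VI §6–7] -/
theorem helper_liftIdx_apply : ∀ (n k k' : ℕ) (M : Type) [TopologicalSpace M] [T2Space M] [ChartedSpace (EuclideanHalfSpace (n + 1)) M] [IsManifold (𝓡∂ (n + 1)) ∞ M] (ι : Type) [Finite ι] (h : ι → Literature.Topology.FourManifolds.HandleAttachingMap n k M) (P₁ : Type) [TopologicalSpace P₁] [ChartedSpace (EuclideanHalfSpace (n + 1)) P₁] [IsManifold (𝓡∂ (n + 1)) ∞ P₁] (D : Literature.Topology.FourManifolds.HandleAttachingMap.MultiAttachmentData h (𝓡∂ (n + 1)) P₁) (g : Literature.Topology.FourManifolds.HandleAttachingMap n k' M) (hg : ∀ i, Disjoint (Set.range g.toFun) (Set.range (h i).toFun)) (y : ↥(Literature.Topology.FourManifolds.handleTube n k')), (D.liftIdx g hg).toFun y = D.jA (Summit.SmoothPoincare4.SmoothPoincare4.Theorems.AcyclicBisectionExists.ModpBraidOrbits.MixedIndexLift.liftPtIdx g hg y) :=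
  fun _ _ _ _ _ _ _ _ _ _ _ _ _ _ _ D g hg y => MixedIndexLift.liftIdx_apply D g hg y

end Summit.SmoothPoincare4.SmoothPoincare4.Theorems.AcyclicBisectionExists.ModpBraidOrbits

end
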